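import Summits.HodgeConjecture.CorCM.MumfordTateRankRibetTypeOnePairsTrichotomy
import Summits.HodgeConjecture.CorCM.MumfordTateRankBaseTimesMultiplicities
import Summits.HodgeConjecture.CorCM.MumfordTateRankEllipticProducts
import Literature.AlgebraicGeometry.Motives.HodgeStructureOfAbelianVarietyBiproduct
import Literature.AlgebraicGeometry.Motives.HodgeLieDiagonal
import Literature.AlgebraicGeometry.Motives.WeilTypeCMDirectSum
import Literature.AlgebraicGeometry.HodgeTheory.NoTypeIVTimesCMGrouping
import HarnessLib

/-!
# Two Ribet-type abelian varieties with a common root: the WEIL-TYPE COUNT on `(⨁_{p+1} A) × (⨁_{q+1} A′)` gives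
# `dim Lie Hg(H¹) < g² + g′²`, and `t(A × A′) = t((⨁ A) × (⨁ A′))` (step one of `t(A × A′) = g² + g′²` for `g ≠ g′`)

COR-CM (cell `pub-hodgecm2`, seat `b27` gen 53, count-neutral Mumford–Tate-rank ladder; theorems only, no definition, no named fact; UNCONDITIONAL —
nothing here uses or asserts HC_CM).  `t := dim MT(H¹·)`.  Sequel of `CorCM/MumfordTateRankRibetTypeOnePairs{Exact,Trichotomy}`, which left the cell
«isomorphic fields, `g ≠ g′`» as `{g² + g′², g² + g′² + 1}`.  HERE `t(A × A′) ≤ g² + g′²`, hence EQUALITY, for Ribet types `(g−1,1)`, `(g′−1,1)` with a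
common root `φ ∘ φ = −D = φ′ ∘ φ′`, `A ≁ A′`.  MECHANISM (Moonen–Zarhin Thm. 0.1 (4) one dimension up, as gen 48ʼs `CorCM/MumfordTateRankTypeIVThreefoldPairs`
for `g = g′`): after `φ′ ↦ −φ′` if necessary the multiplicities of `i√D` are `(g−1, 1)` or `(1, g′−1)`; the DIAGONAL action of `k = ℚ(√−D)` on
`H¹(A^{g′−2} × A′^{g−2})` then has equal multiplicities (WEIL TYPE), its Weil classes are Hodge classes moved by the corner `0 ⊕ Δφ′^*`, and
`Δφ′^* ∈ Lie Hg(⊕ H¹A′) = Δ Lie Hg(H¹A′)`; so `dim Lie Hg(H¹(A^{g′−2} × A′^{g−2})) < g² + g′²` (`corner_not_mem_and_finrank_hodgeLie_lt_of_weilType_of_two_le`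
on the bicone of the DIRECT SUMS `⊕ H¹A`, `⊕ H¹A′`, identified with `H¹` of the powers by Künneth `pi_hodge_one_eq_comapEquiv_biproduct`;
`EndAction.multiplicity_pi`; `finrank_hodgeLie_pi_const_eq`), while `t(A × A′) = t(A^{g′−2} × A′^{g−2})` (`CorCM/MumfordTateRankBaseTimesMultiplicities`).
* §1 **`finrank_hodgeLie_hodge_one_biproduct_prod_biproduct_ribetTypeOne_lt`** (the Weil-type count `2((p+1)n₊ + (q+1)n₊′) = (p+1)g + (q+1)g′` on
  `(⨁_{p+1} A) × (⨁_{q+1} A′)` gives `dim Lie Hg < g² + g′²`); `mtRank_hodge_one_eq_of_isIsogenous_prod_biproduct_prod_biproduct` (`t(A × A′) = t` of it).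
* the sign choice, `t ≤ g² + g′²`, the equality and the complete trichotomy are in the sequel `CorCM/MumfordTateRankRibetTypeOnePairsSameField` (size).

## References
* [MoonenZarhin1999LowDim] B. Moonen, Yu. G. Zarhin, *Hodge classes on abelian varieties of low dimension*, Math. Ann. 315 (1999), Thm. 0.1 (4), §1,
  §3 (3.1), Lemma (3.4), Prop. (3.8) [corpus: paper:arxiv-math_9901113 pp. 1–2, 5–7]. [cite: MoonenZarhin1999LowDim, Thm. 0.1 (4) and §3 (3.1)]
* [Deligne1982HodgeCycles] P. Deligne, LNM 900 (1982), §4 Prop. 4.4 (Weil classes), I §3 Prop. 3.4. [cite: Deligne1982HodgeCycles, §4 Prop. 4.4]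
* [Ribet1983] K. A. Ribet, Amer. J. Math. 105 (1983), Thm. 3. [cite: Ribet1983, Thm. 3]
* [Moonen1999MTNotes] B. Moonen, *Notes on Mumford–Tate groups* (1999), (1.8) (`MT(V^{⊕n}) ≅ MT(V)` diagonally). [cite: Moonen1999MTNotes, (1.8)]
* [VoisinHodgeI2002] C. Voisin, *Hodge Theory and Complex Algebraic Geometry I*, §7.3.2, Thm. 11.40 (Künneth). [cite: VoisinHodgeI2002, §7.3.2]
-/

noncomputable section

open scoped TensorProduct BigOperators
open CategoryTheory CategoryTheory.Limits Module NumberField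

namespace Summit.HodgeConjecture.CorCM

open Literature.AlgebraicGeometry.Motives
open Literature.AlgebraicGeometry.Motives.AbelianVariety
open Literature.AlgebraicGeometry.Motives.HodgeStructure
open Literature.AlgebraicGeometry.HodgeTheory
open Literature.AlgebraicGeometry.ComplexMultiplication
open Literature.AlgebraicGeometry.Pohlmann1968 (isIsogenous_powSucc_biproduct)

variable [HodgeTensorFacts.{0, 0}] {X : AbelianVariety ℂ} {n : ℕ}

/-! ## §1 The Weil-type count on `(⨁_{p+1} A) × (⨁_{q+1} A′)` -/

set_option maxHeartbeats 1600000 in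
/-- **`dim Lie Hg(H¹((⨁_{p+1} A) × (⨁_{q+1} A′))) < g² + g′²`** for `A`, `A′` of Ribet types `(g−1,1)`, `(g′−1,1)` with a common root `D` whose
multiplicities of `i√D` satisfy the WEIL-TYPE COUNT `2((p+1)·n₊(A) + (q+1)·n₊(A′)) = (p+1)g + (q+1)g′`: the corner `0 ⊕ Δφ′^*` of
`Lie Hg(⊕_{q+1} H¹A′) = Δ Lie Hg(H¹A′)` moves the Weil classes of the diagonal `k`-action (`corner_not_mem_and_finrank_hodgeLie_lt_of_weilType_of_two_le`
on the bicone `⊕_{p+1} H¹A → H¹(Y) ← ⊕_{q+1} H¹A′`, Künneth `pi_hodge_one_eq_comapEquiv_biproduct`; `EndAction.multiplicity_pi`;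
`dim Lie Hg(⊕ H) = dim Lie Hg(H)`). [cite: MoonenZarhin1999LowDim, Thm. 0.1 (4) and §3 (3.1)] [cite: Deligne1982HodgeCycles, §4 Prop. 4.4]
[cite: Moonen1999MTNotes, (1.8)] -/
theorem finrank_hodgeLie_hodge_one_biproduct_prod_biproduct_ribetTypeOne_lt {A A' : AbelianVariety ℂ} {p q m : ℕ}
    (hP : IsSmoothProjective m ((⨁ fun _ : Fin (p + 1) => A).prod (⨁ fun _ : Fin (q + 1) => A')).X)
    (hF : IsField A.endAlgebra) (hnR : ¬ IsTotallyReal (EndField A hF)) (φ : A ⟶ A) {D : ℕ} (hD : 0 < D) (hφ : φ ≫ φ = -(D • 𝟙 A))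
    (hAE : Module.finrank ℚ A.endAlgebra = 2)
    (h1 : eigenMultiplicity A φ (Complex.I * (Real.sqrt D : ℂ)) = 1 ∨ eigenMultiplicity A φ (-(Complex.I * (Real.sqrt D : ℂ))) = 1) (hdim : 3 ≤ A.dim)
    (hF' : IsField A'.endAlgebra) (hnR' : ¬ IsTotallyReal (EndField A' hF')) (φ' : A' ⟶ A') (hφ' : φ' ≫ φ' = -(D • 𝟙 A'))
    (hA'E : Module.finrank ℚ A'.endAlgebra = 2)
    (h1' : eigenMultiplicity A' φ' (Complex.I * (Real.sqrt D : ℂ)) = 1 ∨ eigenMultiplicity A' φ' (-(Complex.I * (Real.sqrt D : ℂ))) = 1)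
    (hdim' : 3 ≤ A'.dim)
    (hbal : 2 * ((p + 1) * eigenMultiplicity A φ (Complex.I * (Real.sqrt D : ℂ)) + (q + 1) * eigenMultiplicity A' φ' (Complex.I * (Real.sqrt D : ℂ))) =
      (p + 1) * A.dim + (q + 1) * A'.dim) :
    haveI := BettiUniverse.finite hP 1
    Module.finrank ℚ (BettiUniverse.hodge exists_isReal_hodgeModel_holds hP 1).hodgeLie < A.dim * A.dim + A'.dim * A'.dim := by
  classical
  set X₁ : AbelianVariety ℂ := ⨁ fun _ : Fin (p + 1) => A with hX₁
  set X₂ : AbelianVariety ℂ := ⨁ fun _ : Fin (q + 1) => A' with hX₂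
  have hnP : (X₁.prod X₂).dim = m := schemeDim_eq_holds hP
  subst hnP
  have hT : IsSmoothProjective A.dim A.X := AbelianVariety.isSmoothProjective_holds
  have hT' : IsSmoothProjective A'.dim A'.X := AbelianVariety.isSmoothProjective_holds
  have hP₁ : IsSmoothProjective X₁.dim X₁.X := AbelianVariety.isSmoothProjective_holds
  have hP₂ : IsSmoothProjective X₂.dim X₂.X := AbelianVariety.isSmoothProjective_holds
  haveI := BettiUniverse.finite hP 1
  haveI := BettiUniverse.finite hT 1
  haveI := BettiUniverse.finite hT' 1
  haveI := BettiUniverse.finite hP₁ 1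
  haveI := BettiUniverse.finite hP₂ 1
  -- the Hodge structures: `H_A = H¹A`, `H_A' = H¹A'`, their direct sums `S₁`, `S₂`, and `H = H¹(X₁ × X₂)`
  set HA := BettiUniverse.hodge exists_isReal_hodgeModel_holds hT 1 with hHA
  set HA' := BettiUniverse.hodge exists_isReal_hodgeModel_holds hT' 1 with hHA'
  set H := BettiUniverse.hodge exists_isReal_hodgeModel_holds hP 1 with hHdef
  have h9 : Module.finrank ℚ HA.hodgeLie = A.dim * A.dim := (mtRank_hodge_one_of_ribetTypeOne' hT hF hnR φ hD hφ hAE h1 hdim).2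
  have h9' : Module.finrank ℚ HA'.hodgeLie = A'.dim * A'.dim := (mtRank_hodge_one_of_ribetTypeOne' hT' hF' hnR' φ' hD hφ' hA'E h1' hdim').2
  -- Künneth: `⊕ H¹A = e₁^* H¹X₁`, `⊕ H¹A' = e₂^* H¹X₂`
  have hpi₁ := pi_hodge_one_eq_comapEquiv_biproduct (A := fun _ : Fin (p + 1) => A) (fun _ => hT) hP₁
    exists_isReal_hodgeModel_holds hodgePQ_independent_of_hodgeModel_holds
  have hpi₂ := pi_hodge_one_eq_comapEquiv_biproduct (A := fun _ : Fin (q + 1) => A') (fun _ => hT') hP₂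
    exists_isReal_hodgeModel_holds hodgePQ_independent_of_hodgeModel_holds
  set e₁ := (LinearEquiv.ofBijective
      (∑ c, BettiUniverse.pull (biproduct.π (fun _ : Fin (p + 1) => A) c).hom.hom.hom 1 ∘ₗ LinearMap.proj c :
        (∀ _ : Fin (p + 1), bettiCohomology A.X 1) →ₗ[ℚ] bettiCohomology X₁.X 1)
      (bijective_sum_pull_biproduct_π fun _ : Fin (p + 1) => A)) with he₁
  set e₂ := (LinearEquiv.ofBijective
      (∑ c, BettiUniverse.pull (biproduct.π (fun _ : Fin (q + 1) => A') c).hom.hom.hom 1 ∘ₗ LinearMap.proj c :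
        (∀ _ : Fin (q + 1), bettiCohomology A'.X 1) →ₗ[ℚ] bettiCohomology X₂.X 1)
      (bijective_sum_pull_biproduct_π fun _ : Fin (q + 1) => A')) with he₂
  let j₁ : Hom (HodgeStructure.pi fun _ : Fin (p + 1) => HA) (BettiUniverse.hodge exists_isReal_hodgeModel_holds hP₁ 1) :=
    Hom.ofComapBaseChange e₁ fun r => by rw [hpi₁]; rfl
  let r₁ : Hom (BettiUniverse.hodge exists_isReal_hodgeModel_holds hP₁ 1) (HodgeStructure.pi fun _ : Fin (p + 1) => HA) :=
    Hom.symmOfComapBaseChange e₁ fun r => by rw [hpi₁]; rfl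
  let j₂ : Hom (HodgeStructure.pi fun _ : Fin (q + 1) => HA') (BettiUniverse.hodge exists_isReal_hodgeModel_holds hP₂ 1) :=
    Hom.ofComapBaseChange e₂ fun r => by rw [hpi₂]; rfl
  let r₂ : Hom (BettiUniverse.hodge exists_isReal_hodgeModel_holds hP₂ 1) (HodgeStructure.pi fun _ : Fin (q + 1) => HA') :=
    Hom.symmOfComapBaseChange e₂ fun r => by rw [hpi₂]; rfl
  have hj₁ : ∀ v, j₁.toLinearMap v = e₁ v := fun v => rfl
  have hr₁ : ∀ w, r₁.toLinearMap w = e₁.symm w := fun w => rfl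
  have hj₂ : ∀ v, j₂.toLinearMap v = e₂ v := fun v => rfl
  have hr₂ : ∀ w, r₂.toLinearMap w = e₂.symm w := fun w => rfl
  -- the bicone `⊕ H¹A → H¹(X₁ × X₂) ← ⊕ H¹A'`
  let ι₁ := (BettiUniverse.pullHodgeHom exists_isReal_hodgeModel_holds hodgePQ_independent_of_hodgeModel_holds hP hP₁ (fst X₁ X₂).hom.hom.hom 1).comp j₁
  let π₁ := r₁.comp (BettiUniverse.pullHodgeHom exists_isReal_hodgeModel_holds hodgePQ_independent_of_hodgeModel_holds hP₁ hP
    (prodLift (𝟙 X₁) (0 : X₁ ⟶ X₂)).hom.hom.hom 1)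
  let ι₂ := (BettiUniverse.pullHodgeHom exists_isReal_hodgeModel_holds hodgePQ_independent_of_hodgeModel_holds hP hP₂ (snd X₁ X₂).hom.hom.hom 1).comp j₂
  let π₂ := r₂.comp (BettiUniverse.pullHodgeHom exists_isReal_hodgeModel_holds hodgePQ_independent_of_hodgeModel_holds hP₂ hP
    (prodLift (0 : X₂ ⟶ X₁) (𝟙 X₂)).hom.hom.hom 1)
  have hsumP : fst X₁ X₂ ≫ prodLift (𝟙 X₁) (0 : X₁ ⟶ X₂) + snd X₁ X₂ ≫ prodLift (0 : X₂ ⟶ X₁) (𝟙 X₂) = 𝟙 _ := by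
    refine prod_hom_ext ?_ ?_
    · rw [Preadditive.add_comp, Category.assoc, Category.assoc, prodLift_fst, prodLift_fst, Category.comp_id, comp_zero, add_zero, Category.id_comp]
    · rw [Preadditive.add_comp, Category.assoc, Category.assoc, prodLift_snd, prodLift_snd, Category.comp_id, comp_zero, zero_add, Category.id_comp]
  have hπι₁ : ∀ v, π₁.toLinearMap (ι₁.toLinearMap v) = v := fun v => by
    change r₁.toLinearMap (BettiUniverse.pull (prodLift (𝟙 X₁) (0 : X₁ ⟶ X₂)).hom.hom.hom 1
      (BettiUniverse.pull (fst X₁ X₂).hom.hom.hom 1 (j₁.toLinearMap v))) = v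
    rw [pull_pull_eq_self_of_comp_eq_id (prodLift_fst _ _), hj₁, hr₁, LinearEquiv.symm_apply_apply]
  have hπι₂ : ∀ v, π₂.toLinearMap (ι₂.toLinearMap v) = v := fun v => by
    change r₂.toLinearMap (BettiUniverse.pull (prodLift (0 : X₂ ⟶ X₁) (𝟙 X₂)).hom.hom.hom 1
      (BettiUniverse.pull (snd X₁ X₂).hom.hom.hom 1 (j₂.toLinearMap v))) = v
    rw [pull_pull_eq_self_of_comp_eq_id (prodLift_snd _ _), hj₂, hr₂, LinearEquiv.symm_apply_apply]
  have hsum : ∀ v, ι₁.toLinearMap (π₁.toLinearMap v) + ι₂.toLinearMap (π₂.toLinearMap v) = v := fun v => by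
    change BettiUniverse.pull (fst X₁ X₂).hom.hom.hom 1 (j₁.toLinearMap (r₁.toLinearMap
        (BettiUniverse.pull (prodLift (𝟙 X₁) (0 : X₁ ⟶ X₂)).hom.hom.hom 1 v))) +
      BettiUniverse.pull (snd X₁ X₂).hom.hom.hom 1 (j₂.toLinearMap (r₂.toLinearMap
        (BettiUniverse.pull (prodLift (0 : X₂ ⟶ X₁) (𝟙 X₂)).hom.hom.hom 1 v))) = v
    rw [hj₁, hr₁, hj₂, hr₂, LinearEquiv.apply_symm_apply, LinearEquiv.apply_symm_apply]
    exact pull_pull_add_pull_pull_eq_self _ _ _ _ hsumP v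
  have h12 : ∀ v, π₁.toLinearMap (ι₂.toLinearMap v) = 0 := fun v => by
    have h := congrArg π₁.toLinearMap (hsum (ι₂.toLinearMap v))
    rw [map_add, hπι₂ v, hπι₁] at h
    exact add_eq_left.1 h
  have h21 : ∀ v, π₂.toLinearMap (ι₁.toLinearMap v) = 0 := fun v => by
    have h := congrArg π₂.toLinearMap (hsum (ι₁.toLinearMap v))
    rw [map_add, hπι₁ v, hπι₂] at h
    exact add_eq_left.1 h
  -- `k := End⁰A'`, `c := φ'`, `k → End⁰A` with `c ↦ φ`
  haveI : Module.Finite ℚ (EndField A' hF') := NumberField.to_finiteDimensional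
  have hK2 : Module.finrank ℚ (EndField A' hF') = 2 := by rw [EndField.finrank_eq, hA'E]
  let ρ' : EndField A' hF' →+* A'.endAlgebra := (EndField.toEndAlgebra hF').toRingHom
  let c : EndField A' hF' := (EndField.toEndAlgebra hF').symm (AbelianVariety.endAlgebra.of A' φ')
  have hρ'c : ρ' c = AbelianVariety.endAlgebra.of A' φ' := (EndField.toEndAlgebra hF').apply_symm_apply _
  have hcK : c * c = -((D : ℚ) • (1 : EndField A' hF')) := by
    apply (EndField.toEndAlgebra hF').injective
    rw [map_mul, (EndField.toEndAlgebra hF').apply_symm_apply, endAlgebra_of_mul_self_eq_neg hφ', map_neg, Nat.cast_smul_eq_nsmul,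
      Nat.cast_smul_eq_nsmul, map_nsmul, map_one]
  have hc0 : c ≠ 0 := by
    intro h
    rw [h, mul_zero, eq_comm, neg_eq_zero, smul_eq_zero] at hcK
    rcases hcK with h' | h'
    · exact hD.ne' (by exact_mod_cast h')
    · exact one_ne_zero h'
  obtain ⟨ρT, hρTc⟩ := exists_ringHom_apply_eq_of_sq_eq_neg hK2 (Nat.cast_pos.2 hD) hcK (R := A.endAlgebra)
    (b := AbelianVariety.endAlgebra.of A φ) (endAlgebra_of_mul_self_eq_neg hφ)
  -- the diagonal actions on `⊕ H¹A`, `⊕ H¹A'`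
  let B₁ : EndAction HA (EndField A' hF') := hOneEndAction ρT exists_isReal_hodgeModel_holds hodgePQ_independent_of_hodgeModel_holds
  let B₂ : EndAction HA' (EndField A' hF') := hOneEndAction ρ' exists_isReal_hodgeModel_holds hodgePQ_independent_of_hodgeModel_holds
  let A₁ : EndAction (HodgeStructure.pi fun _ : Fin (p + 1) => HA) (EndField A' hF') := EndAction.pi fun _ => B₁
  let A₂ : EndAction (HodgeStructure.pi fun _ : Fin (q + 1) => HA') (EndField A' hF') := EndAction.pi fun _ => B₂
  -- the diagonal action on `H¹(X₁ × X₂)`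
  let L : EndField A' hF' →ₗ[ℚ] Module.End ℚ (bettiCohomology (X₁.prod X₂).X 1) :=
    { toFun := fun a => ι₁.toLinearMap ∘ₗ A₁.ι a ∘ₗ π₁.toLinearMap + ι₂.toLinearMap ∘ₗ A₂.ι a ∘ₗ π₂.toLinearMap
      map_add' := fun a b => by
        rw [map_add, map_add, LinearMap.add_comp, LinearMap.comp_add, LinearMap.add_comp, LinearMap.comp_add]; abel
      map_smul' := fun q a => by
        rw [map_smul, map_smul, LinearMap.smul_comp, LinearMap.comp_smul, LinearMap.smul_comp, LinearMap.comp_smul, RingHom.id_apply,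
          smul_add] }
  have hL : ∀ a, L a = ι₁.toLinearMap ∘ₗ A₁.ι a ∘ₗ π₁.toLinearMap + ι₂.toLinearMap ∘ₗ A₂.ι a ∘ₗ π₂.toLinearMap := fun a => rfl
  have hL1 : L 1 = 1 := by
    rw [hL, map_one, map_one]
    refine LinearMap.ext fun v => ?_
    rw [LinearMap.add_apply, LinearMap.comp_apply, LinearMap.comp_apply, LinearMap.comp_apply, LinearMap.comp_apply,
      Module.End.one_apply, Module.End.one_apply, Module.End.one_apply, hsum]
  have hLmul : ∀ a b, L (a * b) = L a * L b := by
    intro a b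
    rw [hL, hL, hL, map_mul, map_mul]
    refine LinearMap.ext fun v => ?_
    simp only [LinearMap.add_apply, LinearMap.comp_apply, Module.End.mul_apply, map_add, hπι₁, hπι₂, h12, h21, map_zero,
      add_zero, zero_add]
  have hLmem : ∀ a, L a ∈ H.endAlg := fun a =>
    Subalgebra.add_mem _ (((ι₁.comp (endAlg.toHom ⟨A₁.ι a, fun r => A₁.map_F_le a r⟩)).comp π₁).toLinearMap_mem_endAlg)
      (((ι₂.comp (endAlg.toHom ⟨A₂.ι a, fun r => A₂.map_F_le a r⟩)).comp π₂).toLinearMap_mem_endAlg)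
  let Ad : EndAction H (EndField A' hF') := { ι := AlgHom.ofLinearMap L hL1 hLmul, map_F_le := fun a r => hLmem a r }
  have hAι : ∀ a, Ad.ι a = L a := fun a => rfl
  have hA₁ : ∀ a, Ad.ι a ∘ₗ ι₁.toLinearMap = ι₁.toLinearMap ∘ₗ A₁.ι a := fun a => by
    rw [hAι, hL]
    refine LinearMap.ext fun v => ?_
    simp only [LinearMap.add_apply, LinearMap.comp_apply, hπι₁, h21, map_zero, add_zero]
  have hA₂ : ∀ a, Ad.ι a ∘ₗ ι₂.toLinearMap = ι₂.toLinearMap ∘ₗ A₂.ι a := fun a => by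
    rw [hAι, hL]
    refine LinearMap.ext fun v => ?_
    simp only [LinearMap.add_apply, LinearMap.comp_apply, hπι₂, h12, map_zero, zero_add]
  -- Weil type
  have hsumT := eigenMultiplicity_add_eigenMultiplicity_neg_eq_dim A φ hD hφ
  have hsumT' := eigenMultiplicity_add_eigenMultiplicity_neg_eq_dim A' φ' hD hφ'
  have hdim₁ : X₁.dim = (p + 1) * A.dim := by rw [hX₁, AndreRiemann.dim_biproduct_fin, Finset.sum_const, Finset.card_univ, Fintype.card_fin, smul_eq_mul]
  have hdim₂ : X₂.dim = (q + 1) * A'.dim := by rw [hX₂, AndreRiemann.dim_biproduct_fin, Finset.sum_const, Finset.card_univ, Fintype.card_fin, smul_eq_mul]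
  have hV : Module.finrank ℚ (bettiCohomology (X₁.prod X₂).X 1) = 2 * ((p + 1) * A.dim + (q + 1) * A'.dim) := by
    rw [finrank_bettiCohomology_one, dim_prod, hdim₁, hdim₂]
  have hW : ∀ σ : EndField A' hF' →+* ℂ, 2 * (A₁.multiplicity σ + A₂.multiplicity σ) =
      Module.finrank ℚ (bettiCohomology (X₁.prod X₂).X 1) / 2 := by
    intro σ
    rw [hV, Nat.mul_div_cancel_left _ two_pos, EndAction.multiplicity_pi, EndAction.multiplicity_pi, Finset.sum_const, Finset.sum_const,
      Finset.card_univ, Finset.card_univ, Fintype.card_fin, Fintype.card_fin, smul_eq_mul, smul_eq_mul,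
      multiplicity_hOneEndAction_eq_eigenMultiplicity ρT hK2 hD hcK φ hρTc σ, multiplicity_hOneEndAction_eq_eigenMultiplicity ρ' hK2 hD hcK φ' hρ'c σ]
    rcases apply_eq_or_eq_neg_of_sq_eq_neg hcK σ with h | h <;> rw [h]
    · exact hbal
    · have e1 : eigenMultiplicity A φ (-(Complex.I * (Real.sqrt D : ℂ))) = A.dim - eigenMultiplicity A φ (Complex.I * (Real.sqrt D : ℂ)) := by omega
      have e2 : eigenMultiplicity A' φ' (-(Complex.I * (Real.sqrt D : ℂ))) = A'.dim - eigenMultiplicity A' φ' (Complex.I * (Real.sqrt D : ℂ)) := by omega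
      rw [e1, e2]
      have hle₁ : eigenMultiplicity A φ (Complex.I * (Real.sqrt D : ℂ)) ≤ A.dim := by omega
      have hle₂ : eigenMultiplicity A' φ' (Complex.I * (Real.sqrt D : ℂ)) ≤ A'.dim := by omega
      zify [hle₁, hle₂] at hbal ⊢
      linarith
  have hV₂ : 2 ≤ Module.finrank ℚ (∀ _ : Fin (q + 1), bettiCohomology A'.X 1) := by
    rw [Module.finrank_pi_fintype, Finset.sum_const, Finset.card_univ, Fintype.card_fin, finrank_bettiCohomology_one, smul_eq_mul]
    nlinarith
  have heff := BettiUniverse.hodge_isEffective exists_isReal_hodgeModel_holds hP 1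
  -- `Δφ'^* ∈ Lie Hg(⊕ H¹A') = Δ Lie Hg(H¹A')`
  have hmem : A₂.ι c ∈ (HodgeStructure.pi fun _ : Fin (q + 1) => HA').hodgeLie := by
    have hB₂c : B₂.ι c = (bettiCohomology.map φ'.hom.hom.hom 1).hom := by
      change hOneAlgHom ρ' c = _
      rw [hOneAlgHom_apply, hρ'c, bettiRep_of, MulOpposite.unop_op]
    have hφ'𝔥 : B₂.ι c ∈ HA'.hodgeLie := by rw [hB₂c]; exact bettiMap_mem_hodgeLie_of_ribetTypeOne hT' φ' hD hφ' hA'E h1' hdim'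
    have hΔ : A₂.ι c = ∑ i, LinearMap.single ℚ (fun _ : Fin (q + 1) => bettiCohomology A'.X 1) i ∘ₗ B₂.ι c ∘ₗ LinearMap.proj i := by
      rw [EndAction.pi_ι_apply]
      refine LinearMap.ext fun v => funext fun i => ?_
      rw [HodgeStructure.piMapEnd_apply, LinearMap.sum_apply, Finset.sum_apply, Finset.sum_eq_single i (fun b _ hb => ?_) (fun h => (h (Finset.mem_univ i)).elim)]
      · rw [LinearMap.comp_apply, LinearMap.comp_apply, LinearMap.proj_apply, LinearMap.single_apply, Pi.single_eq_same]
      · rw [LinearMap.comp_apply, LinearMap.comp_apply, LinearMap.single_apply, Pi.single_eq_of_ne (Ne.symm hb)]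
    rw [hΔ]
    exact sum_single_comp_comp_proj_mem_hodgeLie_pi_const HA' hφ'𝔥
  have hlt := (corner_not_mem_and_finrank_hodgeLie_lt_of_weilType_of_two_le ι₁ π₁ ι₂ π₂ hπι₁ hπι₂ hsum A₁ A₂ Ad hA₁ hA₂ heff hK2 hV₂
    hW hc0).2 hmem
  rw [finrank_hodgeLie_pi_const_eq, finrank_hodgeLie_pi_const_eq, h9, h9'] at hlt
  exact hlt

omit [HodgeTensorFacts.{0, 0}] in
/-- `n_{−ρ}(A, −φ) = n_ρ(A, φ)`: `(−φ)^* = −φ^*`. [cite: MoonenZarhin1999LowDim, §2 (2.3)] -/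
theorem eigenMultiplicity_neg_neg {A : AbelianVariety ℂ} (φ : A ⟶ A) (ρ : ℂ) : eigenMultiplicity A (-φ) (-ρ) = eigenMultiplicity A φ ρ := by
  have hE : Module.End.eigenspace (complexBetti.map (-φ).hom.hom.hom 1).hom (-ρ) = Module.End.eigenspace (complexBetti.map φ.hom.hom.hom 1).hom ρ := by
    rw [complexBetti_map_neg_one]
    ext x
    rw [Module.End.mem_eigenspace_iff, Module.End.mem_eigenspace_iff, ModuleCat.hom_neg, LinearMap.neg_apply, neg_smul, neg_inj]
  unfold eigenMultiplicity
  rw [hE]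

/-- **`t(X) = t((⨁_{p+1} A) × (⨁_{q+1} A′))` for `X ∼ A × A′`** (`dim A, dim A′ > 0`): multiplicities of the factors do not change the
Mumford–Tate rank (`CorCM/MumfordTateRankBaseTimesMultiplicities`, applied over the base `⨁ A` and then over the base `A′`).
[cite: MoonenZarhin1999LowDim, §1] [cite: Moonen1999MTNotes, (1.8)] -/
theorem mtRank_hodge_one_eq_of_isIsogenous_prod_biproduct_prod_biproduct (hX : IsSmoothProjective n X.X) {A A' : AbelianVariety ℂ}
    (hA0 : 0 < A.dim) (hA'0 : 0 < A'.dim) (hXP : IsIsogenous X (A.prod A')) {p q m : ℕ}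
    (hY : IsSmoothProjective m ((⨁ fun _ : Fin (p + 1) => A).prod (⨁ fun _ : Fin (q + 1) => A')).X) :
    haveI := BettiUniverse.finite hX 1
    haveI := BettiUniverse.finite hY 1
    (BettiUniverse.hodge exists_isReal_hodgeModel_holds hX 1).mtRank = (BettiUniverse.hodge exists_isReal_hodgeModel_holds hY 1).mtRank := by
  classical
  set X₁ : AbelianVariety ℂ := ⨁ fun _ : Fin (p + 1) => A with hX₁
  have hX₁0 : 0 < X₁.dim := by
    rw [hX₁, AndreRiemann.dim_biproduct_fin, Finset.sum_const, Finset.card_univ, Fintype.card_fin, smul_eq_mul]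
    exact Nat.mul_pos (Nat.succ_pos p) hA0
  have hZ : IsSmoothProjective (A'.prod X₁).dim (A'.prod X₁).X := AbelianVariety.isSmoothProjective_holds
  have h1A' : IsIsogenous (⨁ fun _ : Fin 1 => A') A' := (isIsogenous_powSucc_biproduct A' 0).symm'
  have h1A : IsIsogenous (⨁ fun _ : Fin 1 => A) A := (isIsogenous_powSucc_biproduct A 0).symm'
  -- over the base `X₁ = ⨁ A`: `t(X₁ × ⨁_{q+1} A') = t(A' × X₁)`
  have h₁ := mtRank_hodge_one_eq_of_isIsogenous_prod_biproduct_cls (fun _ : Fin 1 => A') (fun _ : Fin (q + 1) => (0 : Fin 1))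
    (fun i => ⟨0, (Subsingleton.elim _ _)⟩) hY hZ hX₁0 (IsIsogenous.refl _)
    ((isIsogenous_prod_comm A' X₁).trans ((IsIsogenous.refl X₁).prod h1A'.symm'))
  -- over the base `A'`: `t(A' × ⨁_{p+1} A) = t(X)`
  have h₂ := mtRank_hodge_one_eq_of_isIsogenous_prod_biproduct_cls (fun _ : Fin 1 => A) (fun _ : Fin (p + 1) => (0 : Fin 1))
    (fun i => ⟨0, (Subsingleton.elim _ _)⟩) hZ hX hA'0 (IsIsogenous.refl _)
    (hXP.trans ((isIsogenous_prod_comm A A').trans ((IsIsogenous.refl A').prod h1A.symm')))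
  rw [← h₂, ← h₁]

end Summit.HodgeConjecture.CorCM

end
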